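import Summits.BirchSwinnertonDyer.Rank2.LevelFifteenManinTablesDefs
import HarnessLib

/-!
# Manin symbols on `Γ₀(15)`, I: the 24 M-symbol values of a cusp form, their relations, and the certified
# `T`-move / `S`-move identities `W_P − W_{PT} = a₁E₁ + a₂E₂`, `W_P − x_P − W_{PS} = a₁E₁ + a₂E₂`

Cell `bsd-rank2` (D-0036), seat `bsd-rank2-eng` GEN 8 (director-bsd g8, 2026-08-27T09:39:43Z: discharge
`LevelFifteenSymbolParity` as a theorem). For ANY `h ∈ S₂(Γ₀(15))`:

* `msymbolSL_eq_of_row` — `[k']_h = [k]_h` when the bottom rows of `k, k' ∈ SL(2, ℤ)` are proportional mod `15`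
  (`k' k⁻¹ ∈ Γ₀(15)`, tree `msymbolSL_mul_of_mem`);
* `xval_rel2`, `xval_rel3` — the two-term and three-term relations among the 24 values `x_P(h)` (tree
  `msymbolSL_add_msymbolSL_mul_S`, `msymbolSL_three_term`, with the index maps `sIdx`, `tsIdx` certified by `decide`);
* `ev_relComb` — every certified relation combination evaluates to `0`;
* `W_sub_W_tIdx`, `W_sub_xval_sub_W_sIdx` — the 48 move identities, each reduced by `decide` on the integer certificate
  tables of `LevelFifteenManinTablesDefs` to `ev_relComb`.

THEOREMS ONLY; no `sorry`; standard axioms. PARTITION: none — r_an ≥ 2, summit axis S0; TWIN (D-0056): n/a. B1 honesty: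
linear algebra of M-symbols at level 15; no S0 motion.

References: Ju. I. Manin, *Izv. Akad. Nauk SSSR* 36 (1972) §1.7, Thm. 1.9 [Manin1972]; J. E. Cremona, *Algorithms for
modular elliptic curves* (1997) §2.1–§2.3 [CremonaAlgorithms1997].
-/

noncomputable section

open scoped MatrixGroups ModularForm

open CongruenceSubgroup Matrix.SpecialLinearGroup ModularGroup
open Literature.NumberTheory.EllipticCurves.ModularForms

namespace Summit.BirchSwinnertonDyer.Rank2.LevelFifteen

/-! ### §1 M-symbols only see the bottom row modulo the level -/

/-- `[k']_h = [k]_h` when `N ∣ c'd − d'c`, i.e. `k' k⁻¹ ∈ Γ₀(N)` (bottom rows proportional modulo `N`).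
[cite: CremonaAlgorithms1997, §2.2 Prop. 2.2.2] -/
theorem msymbolSL_eq_of_row {N : ℕ} [NeZero N] (h : CuspForm (Gamma0 N) 2) {k k' : SL(2, ℤ)}
    (hdiv : (N : ℤ) ∣ k' 1 0 * k 1 1 - k' 1 1 * k 1 0) : msymbolSL h k' = msymbolSL h k := by
  have hmem : k' * k⁻¹ ∈ Gamma0 N := by
    rw [Gamma0_mem]
    have e : (k' * k⁻¹) 1 0 = k' 1 0 * k 1 1 - k' 1 1 * k 1 0 := by
      rw [Matrix.SpecialLinearGroup.SL2_inv_expl]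
      simp [Matrix.mul_apply, Fin.sum_univ_two]
      ring
    rw [e]
    obtain ⟨t, ht⟩ := hdiv
    rw [ht]; push_cast; simp
  have := msymbolSL_mul_of_mem h hmem k
  rwa [inv_mul_cancel_right] at this

/-! ### §2 Bottom rows of `kS`, `kTS`, `k(TS)²`, and of the representatives -/

/-- Bottom row of `kS`. [folklore] -/
theorem mul_S_apply_10 (k : SL(2, ℤ)) : (k * S) 1 0 = k 1 1 := by
  simp [coe_S, Matrix.mul_apply, Fin.sum_univ_two]

/-- Bottom row of `kS`. [folklore] -/
theorem mul_S_apply_11 (k : SL(2, ℤ)) : (k * S) 1 1 = -k 1 0 := by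
  simp [coe_S, Matrix.mul_apply, Fin.sum_univ_two]

/-- Bottom row of `kTS`. [folklore] -/
theorem mul_TS_apply_10 (k : SL(2, ℤ)) : (k * (T * S)) 1 0 = k 1 0 + k 1 1 := by
  simp [coe_S, coe_T, Matrix.mul_apply, Fin.sum_univ_two]

/-- Bottom row of `kTS`. [folklore] -/
theorem mul_TS_apply_11 (k : SL(2, ℤ)) : (k * (T * S)) 1 1 = -k 1 0 := by
  simp [coe_S, coe_T, Matrix.mul_apply, Fin.sum_univ_two]

/-- Bottom row of `k(TS)²`. [folklore] -/
theorem mul_TS_sq_apply_10 (k : SL(2, ℤ)) : (k * (T * S) ^ 2) 1 0 = k 1 1 := by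
  rw [pow_two, ← mul_assoc, mul_TS_apply_10, mul_TS_apply_10, mul_TS_apply_11]; ring

/-- Bottom row of `k(TS)²`. [folklore] -/
theorem mul_TS_sq_apply_11 (k : SL(2, ℤ)) : (k * (T * S) ^ 2) 1 1 = -k 1 0 - k 1 1 := by
  rw [pow_two, ← mul_assoc, mul_TS_apply_11, mul_TS_apply_10]; ring

/-- Bottom row of the representative. [folklore] -/
@[simp] theorem rep_apply_10 (P : Fin 24) : (rep P) 1 0 = repC P := rfl

/-- Bottom row of the representative. [folklore] -/
@[simp] theorem rep_apply_11 (P : Fin 24) : (rep P) 1 1 = repD P := rfl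

/-! ### §3 The index maps are right (`decide`) and the relations among the 24 values -/

/-- `sIdx` is the class of `rep P · S`. [folklore] -/
theorem sIdx_ok : ∀ P : Fin 24, (15 : ℤ) ∣ repD P * repD (sIdx P) - (-repC P) * repC (sIdx P) := by decide

/-- `tsIdx` is the class of `rep P · TS`. [folklore] -/
theorem tsIdx_ok : ∀ P : Fin 24,
    (15 : ℤ) ∣ (repC P + repD P) * repD (tsIdx P) - (-repC P) * repC (tsIdx P) := by decide

/-- `tsIdx ∘ tsIdx` is the class of `rep P · (TS)²`. [folklore] -/
theorem tsIdx_tsIdx_ok : ∀ P : Fin 24,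
    (15 : ℤ) ∣ repD P * repD (tsIdx (tsIdx P)) - (-repC P - repD P) * repC (tsIdx (tsIdx P)) := by decide

/-- `sIdx` is an involution. [folklore] -/
theorem sIdx_sIdx : ∀ P : Fin 24, sIdx (sIdx P) = P := by decide

/-- `tsIdx` has order `3`. [folklore] -/
theorem tsIdx_tsIdx_tsIdx : ∀ P : Fin 24, tsIdx (tsIdx (tsIdx P)) = P := by decide

variable (h : CuspForm (Gamma0 15) 2)

/-- `[rep P · S] = x_{sIdx P}`. [cite: CremonaAlgorithms1997, §2.2] -/
theorem msymbolSL_rep_mul_S (P : Fin 24) : msymbolSL h (rep P * S) = xval h (sIdx P) :=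
  msymbolSL_eq_of_row h (by rw [mul_S_apply_10, mul_S_apply_11, rep_apply_10, rep_apply_11,
    rep_apply_10, rep_apply_11]; exact_mod_cast sIdx_ok P)

/-- `[rep P · TS] = x_{tsIdx P}`. [cite: CremonaAlgorithms1997, §2.2] -/
theorem msymbolSL_rep_mul_TS (P : Fin 24) : msymbolSL h (rep P * (T * S)) = xval h (tsIdx P) :=
  msymbolSL_eq_of_row h (by rw [mul_TS_apply_10, mul_TS_apply_11, rep_apply_10, rep_apply_11,
    rep_apply_10, rep_apply_11]; exact_mod_cast tsIdx_ok P)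

/-- `[rep P · (TS)²] = x_{tsIdx (tsIdx P)}`. [cite: CremonaAlgorithms1997, §2.2] -/
theorem msymbolSL_rep_mul_TS_sq (P : Fin 24) :
    msymbolSL h (rep P * (T * S) ^ 2) = xval h (tsIdx (tsIdx P)) :=
  msymbolSL_eq_of_row h (by rw [mul_TS_sq_apply_10, mul_TS_sq_apply_11, rep_apply_10, rep_apply_11,
    rep_apply_10, rep_apply_11]; exact_mod_cast tsIdx_tsIdx_ok P)

/-- **Two-term relations** `x_P + x_{PS} = 0`. [cite: CremonaAlgorithms1997, §2.1 (2.1.4)] -/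
theorem xval_rel2 (P : Fin 24) : xval h P + xval h (sIdx P) = 0 := by
  rw [← msymbolSL_rep_mul_S]; exact msymbolSL_add_msymbolSL_mul_S h (rep P)

/-- **Three-term relations** `x_P + x_{P·TS} + x_{P·(TS)²} = 0`. [cite: CremonaAlgorithms1997, §2.1 (2.1.3)] -/
theorem xval_rel3 (P : Fin 24) : xval h P + xval h (tsIdx P) + xval h (tsIdx (tsIdx P)) = 0 := by
  rw [← msymbolSL_rep_mul_TS, ← msymbolSL_rep_mul_TS_sq]; exact msymbolSL_three_term h (rep P)

/-! ### §4 Evaluation of formal vectors and the reflection lemma -/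

section Ev

variable (x : Fin 24 → ℂ)

omit h in
/-- `ev` is additive. [folklore] -/
theorem ev_add (u v : Fin 24 → ℤ) : ev x (u + v) = ev x u + ev x v := by
  simp only [ev, Pi.add_apply, Int.cast_add, add_mul, Finset.sum_add_distrib]

omit h in
/-- `ev` respects subtraction. [folklore] -/
theorem ev_sub (u v : Fin 24 → ℤ) : ev x (u - v) = ev x u - ev x v := by
  simp only [ev, Pi.sub_apply, Int.cast_sub, sub_mul, Finset.sum_sub_distrib]

omit h in
/-- `ev` respects integer scaling. [folklore] -/
theorem ev_smul (a : ℤ) (u : Fin 24 → ℤ) : ev x (a • u) = (a : ℂ) * ev x u := by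
  simp only [ev, Pi.smul_apply, smul_eq_mul, Int.cast_mul, mul_assoc, Finset.mul_sum]

omit h in
/-- `ev` of a unit vector. [folklore] -/
theorem ev_single (P : Fin 24) : ev x (Pi.single P 1) = x P := by
  rw [ev, Finset.sum_eq_single P]
  · simp
  · intro b _ hb; simp [hb]
  · intro hP; exact absurd (Finset.mem_univ P) hP

omit h in
/-- `ev` only depends on the values of the vector. [folklore] -/
theorem ev_congr {u v : Fin 24 → ℤ} (huv : ∀ i, u i = v i) : ev x u = ev x v := by
  rw [show u = v from funext huv]

omit h in
/-- **Reflection lemma**: a certified combination of two-term and three-term relations evaluates to `0` on any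
values satisfying the relations. [cite: Manin1972, Thm. 1.9] -/
theorem ev_relComb (hr2 : ∀ P, x P + x (sIdx P) = 0) (hr3 : ∀ P, x P + x (tsIdx P) + x (tsIdx (tsIdx P)) = 0)
    (m₂ m₃ : Fin 24 → ℤ) : ev x (relComb m₂ m₃) = 0 := by
  -- the permutations `sIdx` (involution) and `tsIdx` (order 3) of `Fin 24`
  let σ : Equiv.Perm (Fin 24) := ⟨sIdx, sIdx, sIdx_sIdx, sIdx_sIdx⟩
  let τ : Equiv.Perm (Fin 24) := ⟨tsIdx, fun i ↦ tsIdx (tsIdx i), fun i ↦ tsIdx_tsIdx_tsIdx i,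
    fun i ↦ tsIdx_tsIdx_tsIdx i⟩
  have h2 : ∑ i, (m₂ (sIdx i) : ℂ) * x i = ∑ i, (m₂ i : ℂ) * x (sIdx i) := by
    rw [← Equiv.sum_comp σ (fun i ↦ (m₂ (sIdx i) : ℂ) * x i)]
    refine Finset.sum_congr rfl fun i _ ↦ ?_
    change (m₂ (sIdx (sIdx i)) : ℂ) * x (sIdx i) = _
    rw [sIdx_sIdx]
  have h3a : ∑ i, (m₃ (tsIdx i) : ℂ) * x i = ∑ i, (m₃ i : ℂ) * x (tsIdx (tsIdx i)) := by
    rw [← Equiv.sum_comp (τ.trans τ) (fun i ↦ (m₃ (tsIdx i) : ℂ) * x i)]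
    refine Finset.sum_congr rfl fun i _ ↦ ?_
    change (m₃ (tsIdx (tsIdx (tsIdx i))) : ℂ) * x (tsIdx (tsIdx i)) = _
    rw [tsIdx_tsIdx_tsIdx]
  have h3b : ∑ i, (m₃ (tsIdx (tsIdx i)) : ℂ) * x i = ∑ i, (m₃ i : ℂ) * x (tsIdx i) := by
    rw [← Equiv.sum_comp τ (fun i ↦ (m₃ (tsIdx (tsIdx i)) : ℂ) * x i)]
    refine Finset.sum_congr rfl fun i _ ↦ ?_
    change (m₃ (tsIdx (tsIdx (tsIdx i))) : ℂ) * x (tsIdx i) = _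
    rw [tsIdx_tsIdx_tsIdx]
  have hsum : ev x (relComb m₂ m₃) =
      (∑ i, (m₂ i : ℂ) * x i + ∑ i, (m₂ (sIdx i) : ℂ) * x i) +
        (∑ i, (m₃ i : ℂ) * x i + ∑ i, (m₃ (tsIdx i) : ℂ) * x i + ∑ i, (m₃ (tsIdx (tsIdx i)) : ℂ) * x i) := by
    simp only [ev, relComb, Int.cast_add, add_mul, Finset.sum_add_distrib]
    ring
  rw [hsum, h2, h3a, h3b, ← Finset.sum_add_distrib, ← Finset.sum_add_distrib, ← Finset.sum_add_distrib]
  have e2 : ∑ i, ((m₂ i : ℂ) * x i + (m₂ i : ℂ) * x (sIdx i)) = 0 :=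
    Finset.sum_eq_zero fun i _ ↦ by rw [← mul_add, hr2 i, mul_zero]
  have e3 : ∑ i, ((m₃ i : ℂ) * x i + (m₃ i : ℂ) * x (tsIdx (tsIdx i)) + (m₃ i : ℂ) * x (tsIdx i)) = 0 :=
    Finset.sum_eq_zero fun i _ ↦ by
      rw [← mul_add, ← mul_add, add_right_comm, hr3 i, mul_zero]
  rw [e2, e3, add_zero]

end Ev

/-! ### §5 The certified move identities -/

/-- Certificate check for the `T`-moves (pure integer arithmetic on the tables). [folklore] -/
theorem tCert_ok : ∀ P i : Fin 24,
    chainTab P i - chainTab (tIdx P) i - tA1 P * e1Tab i - tA2 P * e2Tab i = relComb (tCert2 P) (tCert3 P) i := by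
  decide

/-- Certificate check for the `S`-moves (pure integer arithmetic on the tables). [folklore] -/
theorem sCert_ok : ∀ P i : Fin 24,
    chainTab P i - (Pi.single P (1 : ℤ) : Fin 24 → ℤ) i - chainTab (sIdx P) i - sA1 P * e1Tab i - sA2 P * e2Tab i =
      relComb (sCert2 P) (sCert3 P) i := by
  decide

/-- **`T`-move identity**: `W_P − W_{P·T} = a₁ E₁ + a₂ E₂` with `(a₁, a₂) = (tA1 P, tA2 P)`.
[cite: Manin1972, Thm. 1.9] -/
theorem W_sub_W_tIdx (P : Fin 24) :
    W h P - W h (tIdx P) = (tA1 P : ℂ) * E₁ h + (tA2 P : ℂ) * E₂ h := by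
  have key : ev (xval h) (chainTab P - chainTab (tIdx P) - tA1 P • e1Tab - tA2 P • e2Tab) = 0 := by
    rw [ev_congr (xval h) (v := relComb (tCert2 P) (tCert3 P)) (fun i ↦ by
      simpa [Pi.sub_apply, Pi.smul_apply, smul_eq_mul] using tCert_ok P i)]
    exact ev_relComb (xval h) (xval_rel2 h) (xval_rel3 h) _ _
  rw [ev_sub, ev_sub, ev_sub, ev_smul, ev_smul] at key
  unfold W E₁ E₂
  linear_combination key

/-- **`S`-move identity**: `W_P − x_P − W_{P·S} = a₁ E₁ + a₂ E₂` with `(a₁, a₂) = (sA1 P, sA2 P)`.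
[cite: Manin1972, Thm. 1.9] -/
theorem W_sub_xval_sub_W_sIdx (P : Fin 24) :
    W h P - xval h P - W h (sIdx P) = (sA1 P : ℂ) * E₁ h + (sA2 P : ℂ) * E₂ h := by
  have key : ev (xval h)
      (chainTab P - (Pi.single P (1 : ℤ) : Fin 24 → ℤ) - chainTab (sIdx P) - sA1 P • e1Tab - sA2 P • e2Tab) = 0 := by
    rw [ev_congr (xval h) (v := relComb (sCert2 P) (sCert3 P)) (fun i ↦ by
      simpa [Pi.sub_apply, Pi.smul_apply, smul_eq_mul] using sCert_ok P i)]
    exact ev_relComb (xval h) (xval_rel2 h) (xval_rel3 h) _ _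
  rw [ev_sub, ev_sub, ev_sub, ev_sub, ev_smul, ev_smul, ev_single] at key
  unfold W E₁ E₂
  linear_combination key

end Summit.BirchSwinnertonDyer.Rank2.LevelFifteen

end
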